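/-
Copyright (c) 2026 the pub-hodgecm-mathlib formalisation cell (harness21).  Prover seat hodgecm-mathlib-LH4-p13 (g8), req620 Track A «(D-RAM) FOUR-FRAME» squad, tier 0,
STAGE-1b (heir dealer LH4-plan (g13) D-1b draft v1 §3∕§4 + WORD #53: (L-lab) lane = the (α′) producer `LabelPlusCleanLawAt`): brick (L-lab-14)
«(α′) — THE LEVEL HALF AND THE ASSEMBLY»: at a `T`-fixed self-dual vertex of the unimodular diagonal model, «every diagonal square deep (★ p859483) + level `ℓ` +
fence `m_c ≤ n₁ + ℓ`» forces the square-level token `diag((α−1)², (β−1)², 0)·M ⊆ ϖ^{m_c}M`; transported back through ★ p855032's unimodular diagonal frame this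
is (α′) with the fence made explicit.  2026-09-04.
-/
import Summits.HodgeConjecture.HodgeConjecture.Theorems.F0P3cDyRamModelLabelHermitianClean   -- ★ p859483 (this seat, (L-lab-13)): `not_modelLabel_of_sq_shallow` (hermitian half)
import Summits.HodgeConjecture.HodgeConjecture.Theorems.F0P3cDyRamLabelCountDiagonalModel    -- ★ p859223 (this seat, (L-lab-7)): `latticeLabelPlus_conj_mapGL_iff`, `pairing_diagonal_mulVec_diagonal(_three)`;
                                                                                            -- brings ★ p858764 `latticeInLevel_conj_mapGL_iff`, `coe_conj_sub_one(_mul_self)`, `diagonal_three_sub_one(_mul_self)`,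
                                                                                            -- ★ p855032 `exists_unimodular_diagonal_frame`, ★ Literature `isVertexLattice_formCongr_iff`, `mapGL_conj_mapGL_eq_iff`
import Summits.HodgeConjecture.HodgeConjecture.Theorems.F0P3cDyRamLevelTokenHNF               -- ★ p859056 (LH4-p09 (g8)): `latticeInLevel_iff_forall_smul_mulVec_mem`
import Literature.NumberTheory.Automorphic.UnitaryLatticeTreeApartment                      -- ★ `dualLatt_eq_self_of_isSelfDualLattice`, `mem_mapGL_iff`
import Summits.HodgeConjecture.HodgeConjecture.Theorems.F0P3cDyRamUniformizerPowerTube       -- ★ `v_pow_eq_exp_neg`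
import HarnessLib

/-!
# Crux `H413`, line LH4 «(D-RAM) FOUR-FRAME», STAGE-1b — (L-lab-14) «(α′): THE LEVEL HALF AND THE ASSEMBLY»

Cell `hodgecm-mathlib` (D-0151), FLOOR 0, crux item H413 = `stmt-HodgeConjecture-24833`, route of record `HCCMUnconditional`; squad F0∕P3c∕LH4.  STAGE-1b, heir dealer LH4-plan (g13)
D-1b draft v1 §3 «(L-lab) LH4-p13 (g8)» ∕ §4 ED. 6 gate (2), WORD #53; THEOREMS ONLY (no `def`, no instance, no notation, no `sorry`, default heartbeats), ★-only imports, lane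
`--supports stmt-HodgeConjecture-24833`.

THE MATHEMATICS.  Model: form `h = diag(c)`, `T = diag(α, β, 1)` with `α, β ∈ E¹`, `X = T − 1 = diag(u, w, 0)`, `u = α − 1`, `w = β − 1`, a `T`-stable self-dual `M` (`M = M^♯`,
★ `dualLatt`).  Write `B(y, y′) = c₀σ(uy₀)(uy′₀) + c₁σ(wy₁)(wy′₁) = h(Xy, Xy′)`.
* §1 (KEY BOUND, no label) `v_cross_le_of_latticeInLevel`: if `h` is integral on `M` and `X·M ⊆ ϖ^ℓ M`, then for `y, m ∈ M` with `m₀ = 0`: `|B(y, m)| ≤ |w|·|ϖ^ℓ|` — because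
  `(w∕ϖ^ℓ)m₁e₁ = ϖ^{−ℓ}Xm ∈ M`, so `h(y, ϖ^{−ℓ}Xm) = c₁σ(y₁)(w∕ϖ^ℓ)m₁ ∈ 𝒪`.
* §1 `forall_v_cross_le_of_sq_le`: if moreover every diagonal square is deep, `|B(y, y)| ≤ r` (`y ∈ M`), and `|w|·|ϖ^ℓ| ≤ r`, then `|B(y, y′)| ≤ r` for ALL `y, y′ ∈ M`: order
  `|y′₀| ≤ |y₀|`, put `a = y′₀∕y₀ ∈ 𝒪`, `m = y′ − a·y` (`m₀ = 0`), and split `B(y, y′) = a·B(y, y) + B(y, m)`; the other order is the `σ`-conjugate.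
* §2 `latticeInLevel_sq_of_forall_v_cross_le`: for self-dual `T`-stable `M`, `|B| ≤ |ϖ^m|` on `M × M` gives `X²·M ⊆ ϖ^m M` — since `σu = −u∕α`, `h(y″, X²y) = −B(T⁻¹y″, y)`, so
  `ϖ^{−m}X²y ∈ M^♯ = M`.
* §3 ASSEMBLY (the (α′) law with its fence EXPLICIT, def-free while the ED. 6 leaf is unwritten) `latticeInLevel_sq_of_latticeInLevel_of_latticeLabelPlus`: ramified datum, four-frame
  family, element datum with threshold `N₀`, `Γ_b(α, β)`, a `Γ_b`-fixed type-0 vertex `M` with `(Γ_b − 1)M ⊆ ϖ^ℓ M` and `LatticeLabelPlus σ ϖ d m M (Γ_b − 1)`; then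
  `(Γ_b − 1)²M ⊆ ϖ^{m_c}M` for every `m_c ≤ 2⌊(m + d)∕2⌋` with `m_c ≤ N₀ + ℓ` — transport to ★ p855032's unimodular diagonal model (★ p858764∕p859223 token transport), squares
  deep by ★ p859483 (the label), §1–§2.  At the record letters (`ℓ = d % 2`, `m = m* = mstarOfRecord d`, `m_c = 2⌊(m*+d)∕2⌋ = m* + d − 1`) the fence reads `m_c ≤ N₀ + d % 2`,
  met by `n0CleanOfRecord` exactly for `d ≤ 3` (`d = 2`: `4 ≤ 4`; `d = 3`: `8 ≤ 7 + 1`); `latticeInLevel_sq_of_shell_of_labelPlus_ofRecord` is that instance with numeric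
  schedules `N₀ d ≥ 2⌊(m*+d)∕2⌋ − d % 2` as a hypothesis (the Prop `LabelPlusCleanLawAt N₀ mc` of LH4-p05 (g8) v7 is its `fun`-abstraction once the ED. 6 leaf prints it).
WHY THE FENCE IS SHARP FOR THIS PROOF: without the label only the `v⁰v⁰` Gram entry of `X·M` can be shallow; with it, the cross entry is `≥ n₁ + ℓ` and nothing better
(LH4-p13 (g8) bus 10:42Z: at `d = 4` the record fence `8` is below `m_c − ℓ₀ = 10`).

HONEST LABEL: (L-lab-14) proves the (α′) implication «shell-level `ℓ` ∧ LabelPlus ⇒ square level `m_c`» at every fixed type-0 vertex under the explicit fence `m_c ≤ N₀ + ℓ`;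
it pays no tier-0 row by itself (rows T₊∕T₋∕regular OPEN) and is count-neutral.  HC_CM remains proved only modulo the printed citations (2 remaining named inputs:
hLiu418 = `stmt-HodgeConjecture-24832`, h413 = `stmt-HodgeConjecture-24833`) until rung 0 closes.
-/

noncomputable section

namespace Summit.HodgeConjecture.HodgeConjecture.Cruxes.H413.F0P3cDyRamModelSquareLevelClean

open Literature.NumberTheory.Automorphic Literature.NumberTheory.Automorphic.HermitianLattice Literature.NumberTheory.Automorphic.UnitaryGroup
open Literature.NumberTheory.Automorphic.UnitaryLatticeTree Literature.NumberTheory.Automorphic.UnitaryThreeFourFrame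
open Summit.HodgeConjecture.HodgeConjecture.Cruxes.H413.F0P3cDyRamFourFramePieces
open Summit.HodgeConjecture.HodgeConjecture.Cruxes.H413.F0P3cDyRamFourFrameCensusDefs
open Summit.HodgeConjecture.HodgeConjecture.Cruxes.H413.F0P3cDyRamFixedCountDiagonalModel (exists_unimodular_diagonal_frame)
open Summit.HodgeConjecture.HodgeConjecture.Cruxes.H413.F0P3cDyRamLevelCountDiagonalModel
open Summit.HodgeConjecture.HodgeConjecture.Cruxes.H413.F0P3cDyRamLabelCountDiagonalModel
open Summit.HodgeConjecture.HodgeConjecture.Cruxes.H413.F0P3cDyRamLevelTokenHNF (latticeInLevel_iff_forall_smul_mulVec_mem)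
open Summit.HodgeConjecture.HodgeConjecture.Cruxes.H413.F0P3cDyRamModelLabelHermitianClean (not_modelLabel_of_sq_shallow)
open Summit.HodgeConjecture.HodgeConjecture.Cruxes.H413.F0P3cDyRamUniformizerPowerTube (v_pow_eq_exp_neg)
open scoped Valued WithZero Matrix MatrixGroups
open WithZero

variable {K : Type} [Field K] [Valued K ℤᵐ⁰]

/-! ## §1  The cross bound at level `ℓ` and the reduction to diagonal squares -/

omit [Valued K ℤᵐ⁰] in
/-- `pairing σ diag(d) x y = σx₀·d₀·y₀ + σx₁·d₁·y₁ + σx₂·d₂·y₂`. [cite: Jacobowitz1962, §4] -/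
theorem pairing_diagonal_three (σ : K →+* K) (d x y : Fin 3 → K) :
    pairing σ (Matrix.diagonal d) x y = σ (x 0) * d 0 * y 0 + σ (x 1) * d 1 * y 1 + σ (x 2) * d 2 * y 2 := by
  rw [pairing_apply, Fin.sum_univ_three]
  have h : ∀ i, ∑ j, σ (x i) * Matrix.diagonal d i j * y j = σ (x i) * d i * y i := fun i => by
    rw [Finset.sum_eq_single i (fun j _ hj => by rw [Matrix.diagonal_apply_ne _ (Ne.symm hj), mul_zero, zero_mul])
      (fun h => absurd (Finset.mem_univ i) h), Matrix.diagonal_apply_eq]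
  rw [h, h, h]

omit [Valued K ℤᵐ⁰] in
/-- The coordinates of `(r • diag(e))·w`. [cite: Jacobowitz1962, §4] -/
theorem smul_diagonal_mulVec_apply (r : K) (e w : Fin 3 → K) (i : Fin 3) : ((r • Matrix.diagonal e) *ᵥ w) i = r * (e i * w i) := by
  rw [Matrix.smul_mulVec, Pi.smul_apply, smul_eq_mul, Matrix.mulVec_diagonal]

/-- **KEY BOUND (no label).**  If `h = diag(c)` is integral on `M × M` and `diag(α−1, β−1, 0)·M ⊆ ϖ^ℓ·M`, then for `y, m ∈ M` with `m₀ = 0` the cross value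
`B(y, m) = c₀σ((α−1)y₀)((α−1)m₀) + c₁σ((β−1)y₁)((β−1)m₁)` satisfies `|B(y, m)| ≤ |β − 1|·|ϖ^ℓ|`: the vector `ϖ^{−ℓ}·diag(α−1, β−1, 0)·m = (0, ϖ^{−ℓ}(β−1)m₁, 0)` lies in `M`,
so `h(y, ·)` of it, `σ(y₁)c₁ϖ^{−ℓ}(β−1)m₁`, is integral. [cite: Kottwitz1986BaseChangeUnits, §1 pp. 240–241] [cite: Jacobowitz1962, §4] -/
theorem v_cross_le_of_latticeInLevel {σ : K →+* K} (hvσ : ∀ a, Valued.v (σ a) = Valued.v a) {ϖ : K} (hϖ0 : ϖ ≠ 0) {c : Fin 3 → K} {α β : K} {ℓ : ℕ}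
    {M : Submodule 𝒪[K] (Fin 3 → K)} (hint : ∀ y ∈ M, ∀ y' ∈ M, Valued.v (pairing σ (Matrix.diagonal c) y y') ≤ 1)
    (hlev : LatticeInLevel ϖ ℓ (Matrix.diagonal ![α - 1, β - 1, 0]) M) {y m : Fin 3 → K} (hy : y ∈ M) (hm : m ∈ M) (hm0 : m 0 = 0) :
    Valued.v (c 0 * σ ((α - 1) * y 0) * ((α - 1) * m 0) + c 1 * σ ((β - 1) * y 1) * ((β - 1) * m 1)) ≤ Valued.v (β - 1) * Valued.v (ϖ ^ ℓ) := by
  have hz := (latticeInLevel_iff_forall_smul_mulVec_mem hϖ0 ℓ _ M).1 hlev m hm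
  have hp := hint y hy _ hz
  rw [pairing_diagonal_three, smul_diagonal_mulVec_apply, smul_diagonal_mulVec_apply, smul_diagonal_mulVec_apply] at hp
  simp only [Matrix.cons_val_zero, Matrix.cons_val_one, Matrix.cons_val_two, Matrix.tail_cons, Matrix.head_cons, hm0, mul_zero, zero_mul,
    add_zero, zero_add] at hp
  -- `hp : |σ(y₁)·c₁·(ϖ^{−ℓ}((β−1)m₁))| ≤ 1`
  have hϖℓ : (ϖ ^ ℓ : K) ≠ 0 := pow_ne_zero _ hϖ0
  have key : c 0 * σ ((α - 1) * y 0) * ((α - 1) * m 0) + c 1 * σ ((β - 1) * y 1) * ((β - 1) * m 1) =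
      σ (β - 1) * ϖ ^ ℓ * (σ (y 1) * c 1 * ((ϖ ^ ℓ)⁻¹ * ((β - 1) * m 1))) := by
    have h1 : (ϖ ^ ℓ : K) * (ϖ ^ ℓ)⁻¹ = 1 := mul_inv_cancel₀ hϖℓ
    have h2 : σ (β - 1) * ϖ ^ ℓ * (σ (y 1) * c 1 * ((ϖ ^ ℓ)⁻¹ * ((β - 1) * m 1))) =
        ϖ ^ ℓ * (ϖ ^ ℓ)⁻¹ * (σ (β - 1) * (σ (y 1) * c 1 * ((β - 1) * m 1))) := by ring
    rw [h2, h1, one_mul, hm0]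
    simp only [map_mul, mul_zero, zero_add]
    ring
  rw [key, map_mul, map_mul, hvσ]
  calc Valued.v (β - 1) * Valued.v (ϖ ^ ℓ) * Valued.v (σ (y 1) * c 1 * ((ϖ ^ ℓ)⁻¹ * ((β - 1) * m 1)))
      ≤ Valued.v (β - 1) * Valued.v (ϖ ^ ℓ) * 1 := mul_le_mul_right hp _
    _ = Valued.v (β - 1) * Valued.v (ϖ ^ ℓ) := mul_one _

omit [Valued K ℤᵐ⁰] in
/-- The cross value is `σ`-hermitian: `σ(B(y′, y)) = B(y, y′)` (`σ` an involution fixing `c₀, c₁`). [cite: Jacobowitz1962, §4] -/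
theorem map_cross_swap {σ : K →+* K} (hσ : ∀ x, σ (σ x) = x) {c : Fin 3 → K} (hc₀ : σ (c 0) = c 0) (hc₁ : σ (c 1) = c 1) (α β : K) (y y' : Fin 3 → K) :
    σ (c 0 * σ ((α - 1) * y' 0) * ((α - 1) * y 0) + c 1 * σ ((β - 1) * y' 1) * ((β - 1) * y 1)) =
      c 0 * σ ((α - 1) * y 0) * ((α - 1) * y' 0) + c 1 * σ ((β - 1) * y 1) * ((β - 1) * y' 1) := by
  simp only [map_add, map_mul, hσ, hc₀, hc₁]
  ring

/-- **ALL CROSS VALUES FROM THE SQUARES.**  If `h = diag(c)` (`c₀, c₁` `σ`-fixed, `σ` a valuation-preserving involution) is integral on `M × M`, `diag(α−1, β−1, 0)·M ⊆ ϖ^ℓ·M`,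
every diagonal square satisfies `|B(y, y)| ≤ r` (`y ∈ M`) and `|β − 1|·|ϖ^ℓ| ≤ r`, then `|B(y, y′)| ≤ r` for all `y, y′ ∈ M`: with `|y′₀| ≤ |y₀|`, `a = y′₀∕y₀ ∈ 𝒪` and
`m = y′ − a·y ∈ M` (`m₀ = 0`), `B(y, y′) = a·B(y, y) + B(y, m)` and the key bound; the other order is the `σ`-conjugate. [cite: Kottwitz1986BaseChangeUnits, §1 pp. 240–241]
[cite: Jacobowitz1962, §4] -/
theorem forall_v_cross_le_of_sq_le {σ : K →+* K} (hσ : ∀ x, σ (σ x) = x) (hvσ : ∀ a, Valued.v (σ a) = Valued.v a) {ϖ : K} (hϖ0 : ϖ ≠ 0)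
    {c : Fin 3 → K} (hc₀ : σ (c 0) = c 0) (hc₁ : σ (c 1) = c 1) {α β : K} {ℓ : ℕ} {M : Submodule 𝒪[K] (Fin 3 → K)}
    (hint : ∀ y ∈ M, ∀ y' ∈ M, Valued.v (pairing σ (Matrix.diagonal c) y y') ≤ 1)
    (hlev : LatticeInLevel ϖ ℓ (Matrix.diagonal ![α - 1, β - 1, 0]) M) {r : ℤᵐ⁰}
    (hsq : ∀ y ∈ M, Valued.v (c 0 * σ ((α - 1) * y 0) * ((α - 1) * y 0) + c 1 * σ ((β - 1) * y 1) * ((β - 1) * y 1)) ≤ r)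
    (hw : Valued.v (β - 1) * Valued.v (ϖ ^ ℓ) ≤ r) :
    ∀ y ∈ M, ∀ y' ∈ M, Valued.v (c 0 * σ ((α - 1) * y 0) * ((α - 1) * y' 0) + c 1 * σ ((β - 1) * y 1) * ((β - 1) * y' 1)) ≤ r := by
  -- it suffices to treat the order `|y′₀| ≤ |y₀|`
  suffices h : ∀ y ∈ M, ∀ y' ∈ M, Valued.v (y' 0) ≤ Valued.v (y 0) →
      Valued.v (c 0 * σ ((α - 1) * y 0) * ((α - 1) * y' 0) + c 1 * σ ((β - 1) * y 1) * ((β - 1) * y' 1)) ≤ r by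
    intro y hy y' hy'
    rcases le_total (Valued.v (y' 0)) (Valued.v (y 0)) with h1 | h1
    · exact h y hy y' hy' h1
    · rw [← map_cross_swap hσ hc₀ hc₁ α β y y', hvσ]
      exact h y' hy' y hy h1
  intro y hy y' hy' hle
  by_cases hy0 : y 0 = 0
  · -- then `y′₀ = 0` as well, and the key bound applies directly
    have hy'0 : y' 0 = 0 := by
      rw [hy0, map_zero, le_zero_iff] at hle
      exact (Valuation.zero_iff _).1 hle
    exact (v_cross_le_of_latticeInLevel hvσ hϖ0 hint hlev hy hy' hy'0).trans hw
  · -- reduce `y′` modulo `y` in the `0`-th coordinate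
    have hvy0 : Valued.v (y 0) ≠ 0 := (Valuation.ne_zero_iff _).2 hy0
    have ha1 : Valued.v (y' 0 / y 0) ≤ 1 := by
      rw [map_div₀, div_le_one₀ (zero_lt_iff.2 hvy0)]
      exact hle
    have ham : (y' 0 / y 0) • y ∈ M := by
      have h := M.smul_mem (⟨y' 0 / y 0, (Valuation.mem_integer_iff _ _).2 ha1⟩ : 𝒪[K]) hy
      exact h
    have hmM : y' - (y' 0 / y 0) • y ∈ M := M.sub_mem hy' ham
    have hm0 : (y' - (y' 0 / y 0) • y) 0 = 0 := by
      rw [Pi.sub_apply, Pi.smul_apply, smul_eq_mul, div_mul_cancel₀ _ hy0, sub_self]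
    have hsplit : c 0 * σ ((α - 1) * y 0) * ((α - 1) * y' 0) + c 1 * σ ((β - 1) * y 1) * ((β - 1) * y' 1) =
        y' 0 / y 0 * (c 0 * σ ((α - 1) * y 0) * ((α - 1) * y 0) + c 1 * σ ((β - 1) * y 1) * ((β - 1) * y 1)) +
          (c 0 * σ ((α - 1) * y 0) * ((α - 1) * (y' - (y' 0 / y 0) • y) 0) +
            c 1 * σ ((β - 1) * y 1) * ((β - 1) * (y' - (y' 0 / y 0) • y) 1)) := by
      simp only [Pi.sub_apply, Pi.smul_apply, smul_eq_mul]
      field_simp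
      ring
    rw [hsplit]
    refine (Valuation.map_add _ _ _).trans (max_le ?_ ?_)
    · rw [map_mul]
      calc Valued.v (y' 0 / y 0) * Valued.v (c 0 * σ ((α - 1) * y 0) * ((α - 1) * y 0) + c 1 * σ ((β - 1) * y 1) * ((β - 1) * y 1))
          ≤ 1 * r := mul_le_mul' ha1 (hsq y hy)
        _ = r := one_mul r
    · exact (v_cross_le_of_latticeInLevel hvσ hϖ0 hint hlev hy hmM hm0).trans hw

/-! ## §2  From the cross values to the square-level token (self-dual, `T`-stable `M`) -/

/-- **CROSS VALUES ⇒ SQUARE LEVEL.**  `M` self-dual for `diag(c)` (`M^♯ = M`) and stable under `T = diag(α, β, 1)`, `α, β ∈ E¹`: if `|B(y, y′)| ≤ |ϖ^m|` for all `y, y′ ∈ M`, then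
`diag((α−1)², (β−1)², 0)·M ⊆ ϖ^m·M` — for `y″ ∈ M` one has `T⁻¹y″ ∈ M` and, by `σ(α − 1)·α = −(α − 1)`, `h(y″, X²y) = −B(T⁻¹y″, y)`, so `ϖ^{−m}X²y ∈ M^♯ = M`.
[cite: Kottwitz1986BaseChangeUnits, §1 pp. 240–241] [cite: Jacobowitz1962, §4, §7] -/
theorem latticeInLevel_sq_of_forall_v_cross_le {σ : K →+* K} {ϖ : K} (hϖ0 : ϖ ≠ 0) {c : Fin 3 → K} {α β : K}
    (hα : α * σ α = 1) (hβ : β * σ β = 1) {M : Submodule 𝒪[K] (Fin 3 → K)} (hdual : dualLatt σ (Matrix.diagonal c) M = M)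
    {T : GL (Fin 3) K} (hT : (T : Matrix (Fin 3) (Fin 3) K) = Matrix.diagonal ![α, β, 1]) (hTM : mapGL T M = M) {m : ℕ}
    (hcross : ∀ y ∈ M, ∀ y' ∈ M,
      Valued.v (c 0 * σ ((α - 1) * y 0) * ((α - 1) * y' 0) + c 1 * σ ((β - 1) * y 1) * ((β - 1) * y' 1)) ≤ Valued.v (ϖ ^ m)) :
    LatticeInLevel ϖ m (Matrix.diagonal ![(α - 1) * (α - 1), (β - 1) * (β - 1), 0]) M := by
  have hϖm : (ϖ ^ m : K) ≠ 0 := pow_ne_zero _ hϖ0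
  have hα0 : α ≠ 0 := fun h => by rw [h, zero_mul] at hα; exact zero_ne_one hα
  have hβ0 : β ≠ 0 := fun h => by rw [h, zero_mul] at hβ; exact zero_ne_one hβ
  have hσα : σ α = α⁻¹ := eq_inv_of_mul_eq_one_right hα
  have hσβ : σ β = β⁻¹ := eq_inv_of_mul_eq_one_right hβ
  -- the matrix of `T⁻¹`
  have hTinv : ((T⁻¹ : GL (Fin 3) K) : Matrix (Fin 3) (Fin 3) K) = Matrix.diagonal ![α⁻¹, β⁻¹, 1] := by
    rw [Matrix.coe_units_inv, hT]
    refine Matrix.inv_eq_left_inv ?_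
    rw [Matrix.diagonal_mul_diagonal, ← Matrix.diagonal_one]
    congr 1
    funext i
    fin_cases i <;> simp [hα0, hβ0]
  rw [latticeInLevel_iff_forall_smul_mulVec_mem hϖ0]
  intro y hy
  rw [← hdual, mem_dualLatt]
  intro y'' hy''
  -- `T⁻¹ y″ ∈ M`
  have hy' : ((T⁻¹ : GL (Fin 3) K) : Matrix (Fin 3) (Fin 3) K) *ᵥ y'' ∈ M := (mem_mapGL_iff T M y'').1 (hTM.symm ▸ hy'')
  have hcr := hcross _ hy' y hy
  simp only [hTinv, Matrix.mulVec_diagonal, Matrix.cons_val_zero, Matrix.cons_val_one] at hcr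
  -- `hcr : |c₀σ((α−1)(α⁻¹y″₀))((α−1)y₀) + c₁σ((β−1)(β⁻¹y″₁))((β−1)y₁)| ≤ |ϖ^m|`
  rw [pairing_diagonal_three, smul_diagonal_mulVec_apply, smul_diagonal_mulVec_apply, smul_diagonal_mulVec_apply]
  simp only [Matrix.cons_val_zero, Matrix.cons_val_one, Matrix.cons_val_two, Matrix.tail_cons, Matrix.head_cons, zero_mul, mul_zero, add_zero]
  have key : σ (y'' 0) * c 0 * ((ϖ ^ m)⁻¹ * ((α - 1) * (α - 1) * y 0)) + σ (y'' 1) * c 1 * ((ϖ ^ m)⁻¹ * ((β - 1) * (β - 1) * y 1)) =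
      (ϖ ^ m)⁻¹ * -(c 0 * σ ((α - 1) * (α⁻¹ * y'' 0)) * ((α - 1) * y 0) + c 1 * σ ((β - 1) * (β⁻¹ * y'' 1)) * ((β - 1) * y 1)) := by
    simp only [map_mul, map_sub, map_one, map_inv₀, hσα, hσβ, inv_inv]
    field_simp
    ring
  rw [key, map_mul, Valuation.map_neg, map_inv₀]
  calc (Valued.v (ϖ ^ m))⁻¹ * Valued.v (c 0 * σ ((α - 1) * (α⁻¹ * y'' 0)) * ((α - 1) * y 0) + c 1 * σ ((β - 1) * (β⁻¹ * y'' 1)) * ((β - 1) * y 1))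
      ≤ (Valued.v (ϖ ^ m))⁻¹ * Valued.v (ϖ ^ m) := mul_le_mul_right hcr _
    _ = 1 := inv_mul_cancel₀ ((Valuation.ne_zero_iff _).2 hϖm)

/-! ## §3  Assembly: (α′) at every fixed type-0 vertex, with the fence explicit -/

/-- `2⌊(m* + d)∕2⌋ = m* + d − 1` (`m* + d = d % 2 + 3d − 1` is odd for `d ≥ 1`): the record square level `m_c`. [cite: Rogawski1990, §4.9 Prop. 4.9.1 (b) p. 55] -/
theorem two_mul_mstarOfRecord_add_div_two {d : ℕ} (hd : 1 ≤ d) : 2 * ((mstarOfRecord d + d) / 2) = mstarOfRecord d + d - 1 := by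
  unfold mstarOfRecord
  omega

/-- **(α′) WITH THE FENCE EXPLICIT — «LEVEL `ℓ` ∧ LabelPlus AT DEPTH `m` ⇒ SQUARE LEVEL `m_c`» AT EVERY FIXED TYPE-0 VERTEX.**  Ramified quadratic datum, a four-frame
family `f`, an element datum `(α, β)` with threshold `N₀`, the frame elements `Γ_b = Γ_b(α, β)`; let `M` be a type-0 vertex (for `Φ₃`) fixed by `Γ_b` with
`(Γ_b − 1)·M ⊆ ϖ^ℓ·M` and `LatticeLabelPlus σ ϖ d m M (Γ_b − 1)`.  Then `(Γ_b − 1)²·M ⊆ ϖ^{m_c}·M` for every `m_c ≤ 2⌊(m + d)∕2⌋` with `m_c ≤ N₀ + ℓ`.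
Proof: ★ p855032's unimodular diagonal frame `A` (`ᵗσ(A)Φ₃A = diag(c)`, `Γ_b = A·diag(α, β, 1)·A⁻¹`) transports vertex, fixedness, level and label to the model
(★ `isVertexLattice_formCongr_iff`, `mapGL_conj_mapGL_eq_iff`, ★ p858764 `latticeInLevel_conj_mapGL_iff`, ★ p859223 `latticeLabelPlus_conj_mapGL_iff`); there the label makes
every diagonal square `≤ exp(−2⌊(m+d)∕2⌋)` (★ p859483), the fence gives `|β − 1|·|ϖ^ℓ| ≤ |ϖ^{m_c}|`, §1 bounds every cross value and §2 converts to the square-level token,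
transported back by ★ `coe_conj_sub_one_mul_self`. [cite: Rogawski1990, §4.9 Prop. 4.9.1 (b) p. 55] [cite: Kottwitz1986BaseChangeUnits, §1 pp. 240–241] [cite: Jacobowitz1962, §4, §7] -/
theorem latticeInLevel_sq_of_latticeInLevel_of_latticeLabelPlus {σ : K →+* K} {ϖ : K} {d t : ℕ} (hD : IsRamifiedQuadraticDatum σ ϖ d t)
    {f : Fin 4 → Fin 3 → (Fin 3 → K)} (hf : IsFourFrameFamily σ f) {N₀ : ℕ} {α β : K} {n₁ n₂ n₃ : ℕ} (hE : IsElementDatum σ ϖ N₀ α β n₁ n₂ n₃)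
    {Γ : Fin 4 → GL (Fin 3) K} (hΓ : ∀ b, (Γ b : Matrix (Fin 3) (Fin 3) K) = frameElt σ f b α β) (b : Fin 4)
    {M : Submodule 𝒪[K] (Fin 3 → K)} (hM : IsVertexLattice σ ϖ ((StdForm.antidiagonal 3).over K) 0 M) (hfix : mapGL (Γ b) M = M)
    {ℓ m mc : ℕ} (hlev : LatticeInLevel ϖ ℓ ((Γ b : Matrix (Fin 3) (Fin 3) K) - 1) M)
    (hlab : LatticeLabelPlus σ ϖ d m M ((Γ b : Matrix (Fin 3) (Fin 3) K) - 1)) (hmc : mc ≤ 2 * ((m + d) / 2)) (hN : mc ≤ N₀ + ℓ) :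
    LatticeInLevel ϖ mc (((Γ b : Matrix (Fin 3) (Fin 3) K) - 1) * ((Γ b : Matrix (Fin 3) (Fin 3) K) - 1)) M := by
  obtain ⟨hσ, hvσ, hϖ, heven, hdiff, -, ht⟩ := hD
  obtain ⟨hα, hβ, -, -, -, hn₁, -, -, hN₁, -, -⟩ := hE
  have hϖ0 : ϖ ≠ 0 := (Valuation.ne_zero_iff Valued.v).1 (by rw [hϖ]; exact exp_ne_zero)
  -- the unimodular diagonal model of frame `b`
  obtain ⟨A, c, hc, hσc, -, hA, hconj⟩ := exists_unimodular_diagonal_frame hσ hvσ hϖ heven hf b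
  set T : GL (Fin 3) K := A⁻¹ * Γ b * A with hTdef
  have hΓT : Γ b = A * T * A⁻¹ := by rw [hTdef]; group
  have hT : (T : Matrix (Fin 3) (Fin 3) K) = Matrix.diagonal ![α, β, 1] := by
    rw [hTdef, Units.val_mul, Units.val_mul, hΓ b, hconj α β, ← Matrix.mul_assoc, ← Matrix.mul_assoc, Units.inv_mul, Matrix.one_mul,
      Matrix.mul_assoc, Units.inv_mul, Matrix.mul_one]
  -- the model vertex `M′ = A⁻¹·M`: type 0 for `diag(c)`, fixed by `T`
  have hM' : mapGL A (mapGL A⁻¹ M) = M := mapGL_mapGL_inv A M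
  have hv' : IsVertexLattice σ ϖ (Matrix.diagonal c) 0 (mapGL A⁻¹ M) := by
    rw [← hA, isVertexLattice_formCongr_iff, hM']
    exact hM
  have hfix' : mapGL T (mapGL A⁻¹ M) = mapGL A⁻¹ M := by
    rw [← mapGL_conj_mapGL_eq_iff A, hM', ← hΓT]
    exact hfix
  -- the level operators of `Γ_b` are the `A`-conjugates of the model's diagonal operators
  have hX : (Γ b : Matrix (Fin 3) (Fin 3) K) - 1 =
      (A : Matrix (Fin 3) (Fin 3) K) * Matrix.diagonal ![α - 1, β - 1, 0] * ((A⁻¹ : GL (Fin 3) K) : Matrix (Fin 3) (Fin 3) K) := by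
    rw [hΓT, F0P3cDyRamLevelCountDiagonalModel.coe_conj_sub_one, hT, diagonal_three_sub_one, sub_self]
  have hX2 : ((Γ b : Matrix (Fin 3) (Fin 3) K) - 1) * ((Γ b : Matrix (Fin 3) (Fin 3) K) - 1) =
      (A : Matrix (Fin 3) (Fin 3) K) * Matrix.diagonal ![(α - 1) * (α - 1), (β - 1) * (β - 1), 0] * ((A⁻¹ : GL (Fin 3) K) : Matrix (Fin 3) (Fin 3) K) := by
    rw [hΓT, coe_conj_sub_one_mul_self, hT, diagonal_three_sub_one_mul_self, sub_self, mul_zero]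
  have hlev' : LatticeInLevel ϖ ℓ (Matrix.diagonal ![α - 1, β - 1, 0]) (mapGL A⁻¹ M) := by
    rw [← latticeInLevel_conj_mapGL_iff A, hM', ← hX]
    exact hlev
  have hlab' : {v | ∃ y ∈ mapGL A⁻¹ M, Valued.v ((ϖ ^ m)⁻¹ * (v - (c 0 * (α - 1) * (y 0 * σ (y 0)) + c 1 * (β - 1) * (y 1 * σ (y 1))))) ≤ 1} =
      valueSetMod σ ϖ m (xPlus σ ϖ d) := by
    have h := hlab
    rw [hX, ← hM', latticeLabelPlus_conj_mapGL_iff, hA] at h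
    simpa only [pairing_diagonal_mulVec_diagonal_three] using h
  -- the hermitian half (★ p859483): every diagonal square is `≤ exp(−2⌊(m+d)∕2⌋) ≤ |ϖ^{m_c}|`
  have hn2 : 2 * (((m + d) / 2 : ℕ) : ℤ) ≤ (m : ℤ) + d := by omega
  have hmc' : (mc : ℤ) ≤ 2 * (((m + d) / 2 : ℕ) : ℤ) := by exact_mod_cast hmc
  have hsq : ∀ y ∈ mapGL A⁻¹ M,
      Valued.v (c 0 * σ ((α - 1) * y 0) * ((α - 1) * y 0) + c 1 * σ ((β - 1) * y 1) * ((β - 1) * y 1)) ≤ Valued.v (ϖ ^ mc) := by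
    intro y hy
    have h1 : Valued.v (c 0 * (((α - 1) * y 0) * σ ((α - 1) * y 0)) + c 1 * (((β - 1) * y 1) * σ ((β - 1) * y 1))) ≤
        exp (-(2 * (((m + d) / 2 : ℕ) : ℤ))) := by
      by_contra hlt
      exact not_modelLabel_of_sq_shallow hσ heven hϖ hdiff ht hα hβ (hσc 0) (hσc 1) hy hn2 (not_le.1 hlt) hlab'
    have h2 : c 0 * σ ((α - 1) * y 0) * ((α - 1) * y 0) + c 1 * σ ((β - 1) * y 1) * ((β - 1) * y 1) =
        c 0 * (((α - 1) * y 0) * σ ((α - 1) * y 0)) + c 1 * (((β - 1) * y 1) * σ ((β - 1) * y 1)) := by ring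
    rw [h2, v_pow_eq_exp_neg hϖ]
    refine h1.trans ?_
    rw [exp_le_exp]
    omega
  -- the fence: `|β − 1|·|ϖ^ℓ| = |ϖ^{n₁ + ℓ}| ≤ |ϖ^{m_c}|`
  have hw : Valued.v (β - 1) * Valued.v (ϖ ^ ℓ) ≤ Valued.v (ϖ ^ mc) := by
    rw [hn₁, ← map_pow, ← map_mul, ← pow_add, v_pow_eq_exp_neg hϖ, v_pow_eq_exp_neg hϖ, exp_le_exp]
    push_cast
    omega
  -- self-duality of the model vertex (`diag(c)` is unimodular) and integrality of the form on it
  have hdet : IsUnit (Matrix.diagonal c).det := by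
    rw [Matrix.det_diagonal, isUnit_iff_ne_zero]
    exact Finset.prod_ne_zero_iff.2 fun i _ => (Valuation.ne_zero_iff Valued.v).1 (by rw [hc i]; exact one_ne_zero)
  have hdual : dualLatt σ (Matrix.diagonal c) (mapGL A⁻¹ M) = mapGL A⁻¹ M := dualLatt_eq_self_of_isSelfDualLattice hvσ hdet hv'
  have hint : ∀ y ∈ mapGL A⁻¹ M, ∀ y' ∈ mapGL A⁻¹ M, Valued.v (pairing σ (Matrix.diagonal c) y y') ≤ 1 := fun y hy y' hy' => by
    have h := hy'
    rw [← hdual, mem_dualLatt] at h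
    exact h y hy
  -- §1–§2 in the model, then transport back
  have hcross := forall_v_cross_le_of_sq_le hσ hvσ hϖ0 (hσc 0) (hσc 1) hint hlev' hsq hw
  have hlevel := latticeInLevel_sq_of_forall_v_cross_le hϖ0 hα hβ hdual hT hfix' hcross
  rw [hX2, ← hM', latticeInLevel_conj_mapGL_iff]
  exact hlevel

/-- **(α′) AT THE RECORD LETTERS** (`ℓ₀ = d % 2`, `m* = mstarOfRecord d`, `m_c = 2⌊(m* + d)∕2⌋ = m* + d − 1`), the threshold schedule `N₀` arbitrary with the FENCE
`m_c ≤ N₀ d + d % 2` as a hypothesis: at every `Γ_b`-fixed type-0 vertex in the near-transvection shell `(ℓ₀, m*)` with `LatticeLabelPlus` at `m*`, `(Γ_b − 1)²·M ⊆ ϖ^{m_c}·M`.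
With `N₀ = n0CleanOfRecord` (`m_c∕2 + 2 + parity`, ED. 6 letters) the fence holds exactly for `d ≤ 3` (`d = 1, 2, 3`: `2 ≤ 4`, `4 ≤ 4`, `8 ≤ 8`) — the body of LH4-p05 (g8)'s Prop
`LabelPlusCleanLawAt N₀ (fun d => 2 * ((mstarOfRecord d + d) / 2))` is this statement (binder for binder, plus the unused `[CompleteSpace K] [Fintype 𝓀[K]]`).
[cite: Rogawski1990, §4.9 Prop. 4.9.1 (b) p. 55] [cite: Kottwitz1986BaseChangeUnits, §1 pp. 240–241] -/
theorem latticeInLevel_sq_of_shell_of_labelPlus_ofRecord {σ : K →+* K} {ϖ : K} {d t : ℕ} (hD : IsRamifiedQuadraticDatum σ ϖ d t) (N₀ : ℕ → ℕ)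
    (hN : 2 * ((mstarOfRecord d + d) / 2) ≤ N₀ d + d % 2)
    {f : Fin 4 → Fin 3 → (Fin 3 → K)} (hf : IsFourFrameFamily σ f) {α β : K} {n₁ n₂ n₃ : ℕ} (hE : IsElementDatum σ ϖ (N₀ d) α β n₁ n₂ n₃)
    {Γ : Fin 4 → GL (Fin 3) K} (hΓ : ∀ b, (Γ b : Matrix (Fin 3) (Fin 3) K) = frameElt σ f b α β) (b : Fin 4)
    {M : Submodule 𝒪[K] (Fin 3 → K)} (hM : IsVertexLattice σ ϖ ((StdForm.antidiagonal 3).over K) 0 M) (hfix : mapGL (Γ b) M = M)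
    (hshell : LatticeNearTransvShell ϖ (d % 2) (mstarOfRecord d) ((Γ b : Matrix (Fin 3) (Fin 3) K) - 1) M)
    (hlab : LatticeLabelPlus σ ϖ d (mstarOfRecord d) M ((Γ b : Matrix (Fin 3) (Fin 3) K) - 1)) :
    LatticeInLevel ϖ (2 * ((mstarOfRecord d + d) / 2)) (((Γ b : Matrix (Fin 3) (Fin 3) K) - 1) * ((Γ b : Matrix (Fin 3) (Fin 3) K) - 1)) M :=
  latticeInLevel_sq_of_latticeInLevel_of_latticeLabelPlus hD hf hE hΓ b hM hfix hshell.1 hlab le_rfl hN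

end Summit.HodgeConjecture.HodgeConjecture.Cruxes.H413.F0P3cDyRamModelSquareLevelClean

end
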